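import Mathlib

/-!
# LitRank — printed statements on the rank of a CM type

Blind cell `pub-hodge-repro`, seat lit-2.  Every statement below is typed from the PRINTED
source named in its docstring; the page/line locators (and the verbatim quotes) are in
`route/SOURCES.md`, section `## lit-2`, batch 1 (rows K65-*, D87-*, M89-*, Y85-*).
Sources (lit keys): Kubota 1965 `paper:doi-10-1090-s0002-9947-1965-0190144-8`;
Dodson 1987 `paper:doi-10-1016-0021-8693-87-90242-0`; Mai 1989 `paper:doi-10-1016-0022-314x-89-90025-5`;
Yanai 1985 `paper:doi-10-1017-s0027763000021292`.

## The model (Yanai 1985 §1 p.169, store p0001:L12–40)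

"Let L be the Galois closure of K over Q, and put G = Gal(L/Q), H = Gal(L/K), d = [K:Q]/2.
We can canonically identify the embeddings of K into C with the cosets H\G (G acts on K on
the right).  We denote the complex conjugation by ρ, which belongs to the center of G.  Let S
be a subset of H\G such that H\G = S ∪ Sρ (disjoint union).  The pair (K,S) or the triple
(G,H,S) is called a CM-type.  Put S̃ = {g ∈ G | Hg ∈ S}.  We say that a CM-type (K,S) is simple
if H = {g ∈ G | gS̃ = S̃}."

We record the triple through `S̃ ⊆ G` (a union of right cosets `H g`) — `CMTriple.S` below is
Yanai's `S̃`.  The rank is Kubota's (Lemma 1, p.115, store p0003:L57–61): "let P(G) be the group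
ring of G over a principal ideal domain R.  Let Φ be the operator which maps x ∈ P(G) to
x^Φ = Σ_{σ∈S} xσ.  Then the dimension of P(G)^Φ over R is equal to the rank of the CM-type";
over R = ℚ this is `Module.finrank ℚ (range (x ↦ x * τ))`, `τ = Σ_{σ ∈ S̃} σ`, and we PROVE
(`rank_eq_finrank_span_translates`) that it equals Dodson's form (p.50, store p0002:L28–42: the
rank of the span of the Galois translates Φ^g), i.e. the row rank of the 0/1 matrix of translates.

Faithfulness caveat, stated once: the printed theorems quantify over CM FIELDS; the named
`Prop`s below quantify over abstract triples `(G, H, S̃)` with `ρ` a central involution.  Yanai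
states and proves his results for triples ("the triple (G,H,S) is called a CM-type"), Kubota's
Lemma 1 / Mai's Prop. 1 show the rank is a function of the triple; for Dodson's / Ribet's bounds
the triple form is the form in which the printed proofs are carried out, but it is formally
STRONGER than the field statement unless every triple is realised by a CM field.

SPLIT NOTE (gen 4): this is part 1 of 2 of the former single file `LitRank.lean` (split at the ≤ 400-line rule; text of every declaration unchanged); the later parts are `LitRank`.
-/

open Finset
open scoped Pointwise

namespace HodgeRepro.Lit2

/-- A CM-type as a triple `(G, H, S̃)` in the sense of Yanai 1985 §1 p.169 (see the module
docstring): `H ≤ G`, `ρ` a central involution ("the complex conjugation"), and `S̃ ⊆ G` a union of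
right cosets `H g` with `G = S̃ ⊔ S̃ ρ` (the printed `H\G = S ∪ Sρ`, disjoint). -/
structure CMTriple (G : Type*) [Group G] where
  /-- `H = Gal(L/K)`. -/
  H : Subgroup G
  /-- the complex conjugation `ρ`, central in `G` -/
  ρ : G
  ρ_ne_one : ρ ≠ 1
  ρ_mul_self : ρ * ρ = 1
  ρ_comm : ∀ g : G, ρ * g = g * ρ
  /-- `S̃ = {g ∈ G | Hg ∈ S}` -/
  S : Finset G
  /-- `S̃` is a union of right cosets `H g` -/
  H_mul_mem : ∀ h ∈ H, ∀ g ∈ S, h * g ∈ S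
  /-- `H\G = S ∪ Sρ` (disjoint): exactly one of `g`, `g ρ` lies in `S̃` -/
  mem_iff : ∀ g : G, g ∈ S ↔ g * ρ ∉ S

namespace CMTriple

variable {G : Type*} [Group G] (T : CMTriple G)

/-- `d = [K:Q]/2 = |H\G| / 2` (Yanai p.169). -/
noncomputable def dim : ℕ := T.H.index / 2

/-- Yanai p.169: "We say that a CM-type (K,S) is simple if H = {g ∈ G | gS̃ = S̃}."  The inclusion
`H ⊆ {g | gS̃ = S̃}` is automatic (`H_mul_mem`), so only `⊇` is recorded.  Dodson 1987 p.50 calls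
the same notion "primitive" ("Φ is not the lift of any type on any CM-subfield of K"). -/
def IsSimple [DecidableEq G] : Prop := ∀ g : G, g • T.S = T.S → g ∈ T.H

/-- Simplicity is decidable on a finite group (a bounded quantifier). -/
instance [Fintype G] [DecidableEq G] [DecidablePred (· ∈ T.H)] : Decidable T.IsSimple := by
  unfold IsSimple; infer_instance

/-- Kubota's element `τ = Σ_{σ ∈ S̃} σ` of the group ring `ℚ[G]` (Lemma 1 p.115; Mai p.194
"We denote τ = Σ_{s∈S} s ∈ Z[G]"). -/
noncomputable def tau : MonoidAlgebra ℚ G := ∑ s ∈ T.S, MonoidAlgebra.single s 1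

/-- Kubota 1965 Lemma 1, p.115 (store p0003:L57–61), over `R = ℚ`: the rank of the CM-type is the
dimension of the image of `x ↦ Σ_{σ∈S̃} x σ = x * τ` on `ℚ[G]`. -/
noncomputable def rank : ℕ :=
  Module.finrank ℚ (LinearMap.range (LinearMap.mulRight ℚ T.tau))

/-- Kubota 1965 §2 p.115 (store p0003:L48–50): "We say that (F;{φ_i}) … is nondegenerate if
rank(F;{φ_i}) = m + 1"; Yanai p.170: "If rank(K,S) = d + 1, then we say that the CM-type (K,S) is
nondegenerate." -/
def IsNondegenerate : Prop := T.rank = T.dim + 1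

/-- Kubota 1965 §4 p.118–119 (store p0006:L60–64, p0007:L1–8): "We call the difference
m+1 − rank(F;{φ_i}) the defect of (F;{φ_i})."  (ℕ-subtraction; meaningful because
`rank ≤ dim + 1`, Kubota p.115 "we have obviously rank ≤ m + 1".) -/
noncomputable def defect : ℕ := T.dim + 1 - T.rank

/-! ### Elementary API (proved) -/

/-- `g ρ ∈ S̃ ↔ g ∉ S̃` (the defining property `mem_iff`, negated). -/
theorem mul_ρ_mem_iff (g : G) : g * T.ρ ∈ T.S ↔ g ∉ T.S := by
  rw [T.mem_iff g, not_not]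

/-- `ρ ∉ H` (`K` is totally imaginary: `Hρ ≠ H`). -/
theorem ρ_notMem_H : T.ρ ∉ T.H := by
  intro hρ
  by_cases h : (1 : G) ∈ T.S
  · have h1 : T.ρ * 1 ∈ T.S := T.H_mul_mem _ hρ _ h
    rw [mul_one] at h1
    have h2 : (1 : G) * T.ρ ∉ T.S := (T.mem_iff 1).1 h
    rw [one_mul] at h2
    exact h2 h1
  · have h1 : (1 : G) * T.ρ ∈ T.S := (T.mul_ρ_mem_iff 1).2 h
    rw [one_mul] at h1
    have h2 : T.ρ * T.ρ ∈ T.S := T.H_mul_mem _ hρ _ h1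
    rw [T.ρ_mul_self] at h2
    exact h h2

/-- `H ≠ G`. -/
theorem H_ne_top : T.H ≠ ⊤ := fun h => T.ρ_notMem_H (h ▸ Subgroup.mem_top T.ρ)

section Fintype

variable [Fintype G] [DecidableEq G]

/-- `S̃ ρ = G ∖ S̃` (the printed "H\G = S ∪ Sρ, disjoint"). -/
theorem image_mul_ρ : T.S.image (· * T.ρ) = T.Sᶜ := by
  ext g
  simp only [mem_image, mem_compl]
  constructor
  · rintro ⟨s, hs, rfl⟩
    exact (T.mem_iff s).1 hs
  · intro hg
    refine ⟨g * T.ρ, (T.mul_ρ_mem_iff g).2 hg, ?_⟩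
    rw [mul_assoc, T.ρ_mul_self, mul_one]

/-- `ρ S̃ = G ∖ S̃` (`ρ` is central). -/
theorem smul_S_eq_compl : T.ρ • T.S = T.Sᶜ := by
  rw [← T.image_mul_ρ, smul_finset_def]
  congr 1
  funext s
  exact (T.ρ_comm s)

/-- `2 |S̃| = |G|`, i.e. `|S̃| = [K:ℚ]/2 · |H|`. -/
theorem two_mul_card_S : 2 * T.S.card = Fintype.card G := by
  have h1 : (T.S.image (· * T.ρ)).card = T.S.card :=
    card_image_of_injective _ (mul_left_injective T.ρ)
  rw [T.image_mul_ρ] at h1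
  have h2 := T.S.card_add_card_compl
  omega

/-- In the Galois case (`K = L`, `H = 1`) the printed `d = [K:Q]/2` is `|S̃|`. -/
theorem dim_eq_card_S_of_H_eq_bot (h : T.H = ⊥) : T.dim = T.S.card := by
  unfold dim
  rw [h, Subgroup.index_bot, Nat.card_eq_fintype_card, ← T.two_mul_card_S]
  omega

omit [Fintype G] in
/-- The Galois translate `g S̃` in the group ring: `g · τ = Σ_{s ∈ g S̃} s`. -/
theorem single_mul_tau (g : G) :
    MonoidAlgebra.single g (1 : ℚ) * T.tau = ∑ s ∈ g • T.S, MonoidAlgebra.single s 1 := by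
  unfold tau
  rw [Finset.mul_sum, smul_finset_def,
    Finset.sum_image (fun x _ y _ h => MulAction.injective g h)]
  simp only [MonoidAlgebra.single_mul_single, one_mul, smul_eq_mul]

omit [Fintype G] [DecidableEq G] in
/-- The image of `x ↦ x τ` is the span of the left translates `g τ`. -/
theorem range_mulRight_tau :
    LinearMap.range (LinearMap.mulRight ℚ T.tau) =
      Submodule.span ℚ (Set.range fun g : G => MonoidAlgebra.single g (1 : ℚ) * T.tau) := by
  apply le_antisymm
  · rintro x ⟨y, rfl⟩
    simp only [LinearMap.mulRight_apply]
    induction y using MonoidAlgebra.induction_linear with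
    | zero => simp
    | add a b ha hb => rw [add_mul]; exact Submodule.add_mem _ ha hb
    | single m r =>
      have hr : MonoidAlgebra.single m r = r • MonoidAlgebra.single m (1 : ℚ) := by
        rw [MonoidAlgebra.smul_single', mul_one]
      rw [hr, smul_mul_assoc]
      exact Submodule.smul_mem _ _ (Submodule.subset_span ⟨m, rfl⟩)
  · rw [Submodule.span_le]
    rintro _ ⟨g, rfl⟩
    exact ⟨MonoidAlgebra.single g 1, rfl⟩

omit [Fintype G] in
/-- Kubota's rank (Lemma 1) = Dodson's rank (p.50): the dimension of the span of the Galois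
translates `g S̃`, `g ∈ G` (each translate written as its indicator element of `ℚ[G]`). -/
theorem rank_eq_finrank_span_translates :
    T.rank = Module.finrank ℚ (Submodule.span ℚ
      (Set.range fun g : G => ∑ s ∈ g • T.S, MonoidAlgebra.single s (1 : ℚ))) := by
  unfold rank
  rw [T.range_mulRight_tau]
  have h : (fun g : G => MonoidAlgebra.single g (1 : ℚ) * T.tau) =
      fun g : G => ∑ s ∈ g • T.S, MonoidAlgebra.single s (1 : ℚ) := funext T.single_mul_tau
  rw [h]

/-- The norm element `N = Σ_{g ∈ G} g`. -/
noncomputable def normElt : MonoidAlgebra ℚ G := ∑ g : G, MonoidAlgebra.single g 1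

omit [DecidableEq G] in
/-- `g N = N` for every `g ∈ G`. -/
theorem single_mul_normElt (g : G) :
    MonoidAlgebra.single g (1 : ℚ) * normElt (G := G) = normElt := by
  unfold normElt
  rw [Finset.mul_sum]
  simp only [MonoidAlgebra.single_mul_single, one_mul]
  exact Finset.sum_bij (fun h _ => g * h) (fun _ _ => mem_univ _)
    (fun _ _ _ _ h => mul_right_injective g h)
    (fun h _ => ⟨g⁻¹ * h, mem_univ _, by rw [← mul_assoc, mul_inv_cancel, one_mul]⟩)
    (fun _ _ => rfl)

/-- `τ + ρ τ = N` (the two halves `S̃`, `S̃ ρ` of `G`). -/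
theorem tau_add_ρ_mul_tau : T.tau + MonoidAlgebra.single T.ρ (1 : ℚ) * T.tau = normElt := by
  rw [T.single_mul_tau, T.smul_S_eq_compl]
  unfold tau normElt
  exact Finset.sum_add_sum_compl T.S _

/-- `g τ = N − (g ρ) τ` for every `g` (so the translates by `S̃` together with `N` span all
translates). -/
theorem single_mul_tau_eq_normElt_sub (g : G) :
    MonoidAlgebra.single g (1 : ℚ) * T.tau =
      normElt - MonoidAlgebra.single (g * T.ρ) (1 : ℚ) * T.tau := by
  have h := congrArg (fun x => MonoidAlgebra.single g (1 : ℚ) * x) T.tau_add_ρ_mul_tau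
  simp only [mul_add, ← mul_assoc, MonoidAlgebra.single_mul_single, mul_one,
    single_mul_normElt] at h
  rw [← h]
  abel

/-- Kubota 1965 p.115 "we have obviously rank(F;{φ_i}) ≤ m + 1", in the form valid for every
triple: `rank ≤ |S̃| + 1` (in the Galois case `|S̃| = d`, see `rank_le_dim_add_one_of_H_eq_bot`). -/
theorem rank_le_card_S_add_one : T.rank ≤ T.S.card + 1 := by
  unfold rank
  rw [T.range_mulRight_tau]
  set F : Finset (MonoidAlgebra ℚ G) :=
    insert normElt (T.S.image fun g => MonoidAlgebra.single g (1 : ℚ) * T.tau) with hF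
  have hle : Submodule.span ℚ (Set.range fun g : G => MonoidAlgebra.single g (1 : ℚ) * T.tau) ≤
      Submodule.span ℚ (F : Set (MonoidAlgebra ℚ G)) := by
    rw [Submodule.span_le]
    rintro _ ⟨g, rfl⟩
    beta_reduce
    by_cases hg : g ∈ T.S
    · apply Submodule.subset_span
      simp only [hF, coe_insert, coe_image, Set.mem_insert_iff, Set.mem_image, mem_coe]
      exact Or.inr ⟨g, hg, rfl⟩
    · rw [T.single_mul_tau_eq_normElt_sub g]
      apply Submodule.sub_mem
      · apply Submodule.subset_span
        simp [hF]
      · apply Submodule.subset_span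
        simp only [hF, coe_insert, coe_image, Set.mem_insert_iff, Set.mem_image, mem_coe]
        exact Or.inr ⟨g * T.ρ, (T.mul_ρ_mem_iff g).2 hg, rfl⟩
  calc Module.finrank ℚ (Submodule.span ℚ
        (Set.range fun g : G => MonoidAlgebra.single g (1 : ℚ) * T.tau))
      ≤ Module.finrank ℚ (Submodule.span ℚ (F : Set (MonoidAlgebra ℚ G))) :=
        Submodule.finrank_mono hle
    _ ≤ F.card := finrank_span_finset_le_card F
    _ ≤ T.S.card + 1 := (card_insert_le _ _).trans (by
        have := card_image_le (s := T.S) (f := fun g => MonoidAlgebra.single g (1 : ℚ) * T.tau)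
        omega)

/-- Kubota 1965 p.115 / Dodson 1987 Theorem 1.0 (ii) ("t ∈ S(n) implies t ≤ n + 1"), Galois case. -/
theorem rank_le_dim_add_one_of_H_eq_bot (h : T.H = ⊥) : T.rank ≤ T.dim + 1 := by
  rw [T.dim_eq_card_S_of_H_eq_bot h]
  exact T.rank_le_card_S_add_one

/-! ### Right translates (Yanai 1985 Prop. A (b), proved) -/

omit [Fintype G] in
/-- `x ∈ S̃ g ↔ x g⁻¹ ∈ S̃`. -/
theorem mem_image_mul_right_iff (g x : G) : x ∈ T.S.image (· * g) ↔ x * g⁻¹ ∈ T.S := by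
  rw [mem_image]
  constructor
  · rintro ⟨s, hs, rfl⟩
    simpa [mul_assoc] using hs
  · intro h
    exact ⟨x * g⁻¹, h, by simp [mul_assoc]⟩

omit [Fintype G] in
/-- Yanai 1985 Prop. A (b), p.170 (store p0002:L21–36): "For any g ∈ G, (K, Sg) is also a
CM-type" — the right translate `(G, H, S̃ g)`. -/
def rightTranslate (g : G) : CMTriple G where
  H := T.H
  ρ := T.ρ
  ρ_ne_one := T.ρ_ne_one
  ρ_mul_self := T.ρ_mul_self
  ρ_comm := T.ρ_comm
  S := T.S.image (· * g)
  H_mul_mem := by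
    intro h hh x hx
    rw [mem_image] at hx ⊢
    obtain ⟨s, hs, rfl⟩ := hx
    exact ⟨h * s, T.H_mul_mem h hh s hs, by rw [mul_assoc]⟩
  mem_iff := by
    intro x
    rw [T.mem_image_mul_right_iff, T.mem_image_mul_right_iff, T.mem_iff (x * g⁻¹), mul_assoc,
      ← T.ρ_comm g⁻¹, ← mul_assoc]

omit [Fintype G] in
/-- `τ(S̃ g) = τ · g`. -/
theorem tau_rightTranslate (g : G) :
    (T.rightTranslate g).tau = T.tau * MonoidAlgebra.single g 1 := by
  change ∑ s ∈ T.S.image (· * g), MonoidAlgebra.single s (1 : ℚ) = _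
  unfold tau
  rw [Finset.sum_mul, Finset.sum_image (fun x _ y _ h => mul_left_injective g h)]
  simp only [MonoidAlgebra.single_mul_single, mul_one]

omit [Fintype G] [DecidableEq G] in
/-- Right multiplication by `g` as a linear automorphism of `ℚ[G]`. -/
noncomputable def mulRightEquiv (g : G) : MonoidAlgebra ℚ G ≃ₗ[ℚ] MonoidAlgebra ℚ G :=
  LinearEquiv.ofLinear (LinearMap.mulRight ℚ (MonoidAlgebra.single g 1))
    (LinearMap.mulRight ℚ (MonoidAlgebra.single g⁻¹ 1))
    (by ext x; simp [mul_assoc, MonoidAlgebra.single_mul_single])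
    (by ext x; simp [mul_assoc, MonoidAlgebra.single_mul_single])

omit [Fintype G] in
/-- Yanai 1985 Prop. A (b): "rank(K, Sg) = rank(K, S)". -/
theorem rank_rightTranslate (g : G) : (T.rightTranslate g).rank = T.rank := by
  unfold rank
  rw [T.tau_rightTranslate]
  have h : LinearMap.mulRight ℚ (T.tau * MonoidAlgebra.single g (1 : ℚ)) =
      (mulRightEquiv (G := G) g : MonoidAlgebra ℚ G →ₗ[ℚ] MonoidAlgebra ℚ G).comp
        (LinearMap.mulRight ℚ T.tau) := by
    ext x
    simp [mulRightEquiv, mul_assoc]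
  rw [h, LinearMap.range_comp, LinearEquiv.finrank_map_eq]

end Fintype

end CMTriple

end HodgeRepro.Lit2
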